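import Mathlib
import Summits.Ventures.PercRepro2.Graph
import Summits.Ventures.PercRepro2.RestrictClosure

/-!
# The (SEP-3) class, I: the two gates of a separating pair and the alternating-path formulas
(blind cell PercRepro2, typer-1 g49; LEAD-SEP3.md §1, S3-CLASSES §S3.8 and (G7))

Setting: `A = {a₁, a₃}`, `K = C_{G − A}(o)` the component of the root `o` in `G − A`
(`SepPair.sepConfig`), `F₁ = touches K`, `F₂ = F₁ᶜ`; `C₁ u v` = `u ↔ v` inside `F₁`,
`C₂ u v` = inside `F₂`.  An open path alternates between `F₁`-segments (which stay in `K ∪ A`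
once they start there) and `F₂`-segments (which never enter `K`), switching only at the two
gates `a₁, a₃`; with two gates every chain collapses to at most three segments:

* `conn_iff_of_mem_union` (start `u ∈ K ∪ A`): `u ↔ z` iff `C₁ u z`, or `C₁ u k ∧ C₂ k z`, or
  `C₁ u k ∧ C₂ k k' ∧ C₁ k' z` for gates `k, k'`;
* `conn_iff_of_not_mem` (start `v ∉ K`): the same with the roles of `F₁`, `F₂` exchanged.

Both by the closure lemma `SepPair.mem_of_conn_of_closed'`: the set of vertices reachable by
such a chain is closed under open adjacency, the chain collapsing at a gate because there are
only two (`eq_or_eq_of_mem_pair`).  `SepThreeGates.lean` derives the gate formulas of the five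
marks.  Own work (mine-2's closure / exit lemmas of `RestrictClosure.lean`); standard axioms.
-/

namespace Summit.Ventures.PercRepro2

namespace SepThreeGcZero

open SepPair

section Pair

variable {V : Type*}

/-- Three elements of a pair, the last two distinct: the first equals one of them. -/
lemma eq_or_eq_of_mem_pair {a b x y z : V} (hx : x ∈ ({a, b} : Set V))
    (hy : y ∈ ({a, b} : Set V)) (hz : z ∈ ({a, b} : Set V)) (hne : z ≠ y) : x = z ∨ x = y := by
  simp only [Set.mem_insert_iff, Set.mem_singleton_iff] at hx hy hz
  rcases hx with rfl | rfl <;> rcases hy with rfl | rfl <;> rcases hz with rfl | rfl <;>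
    first | exact absurd rfl hne | exact Or.inl rfl | exact Or.inr rfl

/-- `Conn` is symmetric, as an `iff`. -/
lemma conn_comm {E : Type*} {ends : E → Sym2 V} {ω : Config E} (u v : V) :
    Conn ends ω u v ↔ Conn ends ω v u :=
  ⟨conn_symm, conn_symm⟩

end Pair

/-! ## The alternating-path formulas -/

section Reach

variable {V : Type*} {E : Type*} {ends : E → Sym2 V} {o a₁ a₃ : V}

/-- A gate is not in `K`. -/
lemma not_mem_cluster_of_mem_pair (ho : o ∉ ({a₁, a₃} : Set V)) {k : V}
    (hk : k ∈ ({a₁, a₃} : Set V)) : k ∉ cluster ends (sepConfig ends {a₁, a₃}) o :=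
  fun hkK => not_mem_of_conn_sepConfig ho hkK hk

/-- A vertex outside `K ∪ A` is not reached inside `F₁` from a vertex of `K ∪ A`. -/
lemma not_conn_restrictTo_of_not_mem_union (ho : o ∉ ({a₁, a₃} : Set V)) {u : V}
    (hu : u ∈ cluster ends (sepConfig ends {a₁, a₃}) o ∪ {a₁, a₃}) {w : V}
    (hw : w ∉ cluster ends (sepConfig ends {a₁, a₃}) o ∪ {a₁, a₃})
    [DecidablePred (· ∈ touches ends (cluster ends (sepConfig ends {a₁, a₃}) o))] (ω : Config E) :
    ¬ Conn ends (restrictTo (touches ends (cluster ends (sepConfig ends {a₁, a₃}) o)) ω) u w :=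
  fun h => hw (mem_union_of_conn_restrictTo_touches ho hu h)

variable [DecidablePred (· ∈ touches ends (cluster ends (sepConfig ends {a₁, a₃}) o))]
  [DecidablePred (· ∈ (touches ends (cluster ends (sepConfig ends {a₁, a₃}) o))ᶜ)]

/-- **Reach from the `o`-side.**  For `u ∈ K ∪ A`: `u ↔ z` iff `z` is reached inside `F₁`, or
inside `F₁` to a gate and then inside `F₂`, or `F₁`–gate–`F₂`–gate–`F₁`. -/
theorem conn_iff_of_mem_union (ho : o ∉ ({a₁, a₃} : Set V)) {u : V}
    (hu : u ∈ cluster ends (sepConfig ends {a₁, a₃}) o ∪ {a₁, a₃}) (ω : Config E) (z : V) :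
    Conn ends ω u z ↔
      Conn ends (restrictTo (touches ends (cluster ends (sepConfig ends {a₁, a₃}) o)) ω) u z ∨
      (∃ k ∈ ({a₁, a₃} : Set V),
        Conn ends (restrictTo (touches ends (cluster ends (sepConfig ends {a₁, a₃}) o)) ω) u k ∧
        Conn ends (restrictTo (touches ends (cluster ends (sepConfig ends {a₁, a₃}) o))ᶜ ω) k z) ∨
      (∃ k ∈ ({a₁, a₃} : Set V), ∃ k' ∈ ({a₁, a₃} : Set V),
        Conn ends (restrictTo (touches ends (cluster ends (sepConfig ends {a₁, a₃}) o)) ω) u k ∧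
        Conn ends (restrictTo (touches ends (cluster ends (sepConfig ends {a₁, a₃}) o))ᶜ ω) k k' ∧
        Conn ends (restrictTo (touches ends (cluster ends (sepConfig ends {a₁, a₃}) o)) ω) k' z) := by
  constructor
  · intro h
    refine mem_of_conn_of_closed' (S := {z |
      Conn ends (restrictTo (touches ends (cluster ends (sepConfig ends {a₁, a₃}) o)) ω) u z ∨
      (∃ k ∈ ({a₁, a₃} : Set V),
        Conn ends (restrictTo (touches ends (cluster ends (sepConfig ends {a₁, a₃}) o)) ω) u k ∧
        Conn ends (restrictTo (touches ends (cluster ends (sepConfig ends {a₁, a₃}) o))ᶜ ω) k z) ∨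
      (∃ k ∈ ({a₁, a₃} : Set V), ∃ k' ∈ ({a₁, a₃} : Set V),
        Conn ends (restrictTo (touches ends (cluster ends (sepConfig ends {a₁, a₃}) o)) ω) u k ∧
        Conn ends (restrictTo (touches ends (cluster ends (sepConfig ends {a₁, a₃}) o))ᶜ ω) k k' ∧
        Conn ends (restrictTo (touches ends (cluster ends (sepConfig ends {a₁, a₃}) o)) ω) k' z)})
      ?_ (Or.inl (conn_refl _ _ _)) h
    intro e x y he hends hx
    simp only [Set.mem_setOf_eq] at hx ⊢
    by_cases heF : e ∈ touches ends (cluster ends (sepConfig ends {a₁, a₃}) o)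
    · -- the edge lies in `F₁`
      have hxy : Conn ends (restrictTo (touches ends (cluster ends (sepConfig ends {a₁, a₃}) o)) ω)
          x y := conn_of_openAdj ⟨e, restrictTo_eq_true_of_mem heF he, hends⟩
      rcases hx with hx | ⟨k, hk, huk, hkx⟩ | ⟨k, hk, k', hk', huk, hkk', hk'x⟩
      · exact Or.inl (conn_trans hx hxy)
      · -- `x` was reached inside `F₂` from a gate: `x ∉ K`, and the `F₁`-edge puts `x ∈ K ∪ A`
        have hxK : x ∉ cluster ends (sepConfig ends {a₁, a₃}) o :=
          not_mem_of_conn_restrictTo_compl (not_mem_cluster_of_mem_pair ho hk) hkx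
        have hxA : x ∈ ({a₁, a₃} : Set V) := by
          rcases (endpoints_mem_of_mem_touches_cluster ho heF hends).1 with hxK' | hxA
          · exact absurd hxK' hxK
          · exact hxA
        exact Or.inr (Or.inr ⟨k, hk, x, hxA, huk, hkx, hxy⟩)
      · exact Or.inr (Or.inr ⟨k, hk, k', hk', huk, hkk', conn_trans hk'x hxy⟩)
    · -- the edge lies in `F₂`
      have heF₂ : e ∈ (touches ends (cluster ends (sepConfig ends {a₁, a₃}) o))ᶜ := heF
      have hxy : Conn ends
          (restrictTo (touches ends (cluster ends (sepConfig ends {a₁, a₃}) o))ᶜ ω) x y :=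
        conn_of_openAdj ⟨e, restrictTo_eq_true_of_mem heF₂ he, hends⟩
      rcases hx with hx | ⟨k, hk, huk, hkx⟩ | ⟨k, hk, k', hk', huk, hkk', hk'x⟩
      · -- `x` reached inside `F₁` from `u ∈ K ∪ A` lies in `K ∪ A`; not in `K` (the edge
        -- does not touch `K`), hence a gate
        have hxA : x ∈ ({a₁, a₃} : Set V) := by
          rcases mem_union_of_conn_restrictTo_touches ho hu hx with hxK | hxA
          · exact absurd (mem_touches_of_ends hends (Or.inl hxK)) heF
          · exact hxA
        exact Or.inr (Or.inl ⟨x, hxA, hx, hxy⟩)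
      · exact Or.inr (Or.inl ⟨k, hk, huk, conn_trans hkx hxy⟩)
      · -- `x` reached inside `F₁` from the gate `k'` is a gate; collapse the chain
        have hxA : x ∈ ({a₁, a₃} : Set V) := by
          rcases mem_union_of_conn_restrictTo_touches ho (Or.inr hk') hk'x with hxK | hxA
          · exact absurd (mem_touches_of_ends hends (Or.inl hxK)) heF
          · exact hxA
        by_cases hxk' : x = k'
        · subst hxk'
          exact Or.inr (Or.inl ⟨k, hk, huk, conn_trans hkk' hxy⟩)
        · rcases eq_or_eq_of_mem_pair hk hk' hxA hxk' with hkx | hkk'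
          · subst hkx
            exact Or.inr (Or.inl ⟨k, hk, huk, hxy⟩)
          · subst hkk'
            exact Or.inr (Or.inl ⟨x, hxA, conn_trans huk hk'x, hxy⟩)
  · rintro (h | ⟨k, _, huk, hkz⟩ | ⟨k, _, k', _, huk, hkk', hk'z⟩)
    · exact conn_of_conn_restrictTo h
    · exact conn_trans (conn_of_conn_restrictTo huk) (conn_of_conn_restrictTo hkz)
    · exact conn_trans (conn_of_conn_restrictTo huk)
        (conn_trans (conn_of_conn_restrictTo hkk') (conn_of_conn_restrictTo hk'z))

/-- **Reach from outside `K`.**  For `v ∉ K`: `v ↔ z` iff `z` is reached inside `F₂`, or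
inside `F₂` to a gate and then inside `F₁`, or `F₂`–gate–`F₁`–gate–`F₂`. -/
theorem conn_iff_of_not_mem (ho : o ∉ ({a₁, a₃} : Set V)) {v : V}
    (hv : v ∉ cluster ends (sepConfig ends {a₁, a₃}) o) (ω : Config E) (z : V) :
    Conn ends ω v z ↔
      Conn ends (restrictTo (touches ends (cluster ends (sepConfig ends {a₁, a₃}) o))ᶜ ω) v z ∨
      (∃ k ∈ ({a₁, a₃} : Set V),
        Conn ends (restrictTo (touches ends (cluster ends (sepConfig ends {a₁, a₃}) o))ᶜ ω) v k ∧
        Conn ends (restrictTo (touches ends (cluster ends (sepConfig ends {a₁, a₃}) o)) ω) k z) ∨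
      (∃ k ∈ ({a₁, a₃} : Set V), ∃ k' ∈ ({a₁, a₃} : Set V),
        Conn ends (restrictTo (touches ends (cluster ends (sepConfig ends {a₁, a₃}) o))ᶜ ω) v k ∧
        Conn ends (restrictTo (touches ends (cluster ends (sepConfig ends {a₁, a₃}) o)) ω) k k' ∧
        Conn ends (restrictTo (touches ends (cluster ends (sepConfig ends {a₁, a₃}) o))ᶜ ω) k' z) := by
  constructor
  · intro h
    refine mem_of_conn_of_closed' (S := {z |
      Conn ends (restrictTo (touches ends (cluster ends (sepConfig ends {a₁, a₃}) o))ᶜ ω) v z ∨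
      (∃ k ∈ ({a₁, a₃} : Set V),
        Conn ends (restrictTo (touches ends (cluster ends (sepConfig ends {a₁, a₃}) o))ᶜ ω) v k ∧
        Conn ends (restrictTo (touches ends (cluster ends (sepConfig ends {a₁, a₃}) o)) ω) k z) ∨
      (∃ k ∈ ({a₁, a₃} : Set V), ∃ k' ∈ ({a₁, a₃} : Set V),
        Conn ends (restrictTo (touches ends (cluster ends (sepConfig ends {a₁, a₃}) o))ᶜ ω) v k ∧
        Conn ends (restrictTo (touches ends (cluster ends (sepConfig ends {a₁, a₃}) o)) ω) k k' ∧
        Conn ends (restrictTo (touches ends (cluster ends (sepConfig ends {a₁, a₃}) o))ᶜ ω) k' z)})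
      ?_ (Or.inl (conn_refl _ _ _)) h
    intro e x y he hends hx
    simp only [Set.mem_setOf_eq] at hx ⊢
    by_cases heF : e ∈ touches ends (cluster ends (sepConfig ends {a₁, a₃}) o)
    · -- the edge lies in `F₁`
      have hxy : Conn ends (restrictTo (touches ends (cluster ends (sepConfig ends {a₁, a₃}) o)) ω)
          x y := conn_of_openAdj ⟨e, restrictTo_eq_true_of_mem heF he, hends⟩
      rcases hx with hx | ⟨k, hk, hvk, hkx⟩ | ⟨k, hk, k', hk', hvk, hkk', hk'x⟩
      · -- `x` reached inside `F₂` from `v ∉ K` is outside `K`; the `F₁`-edge makes it a gate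
        have hxK : x ∉ cluster ends (sepConfig ends {a₁, a₃}) o :=
          not_mem_of_conn_restrictTo_compl hv hx
        have hxA : x ∈ ({a₁, a₃} : Set V) := by
          rcases (endpoints_mem_of_mem_touches_cluster ho heF hends).1 with hxK' | hxA
          · exact absurd hxK' hxK
          · exact hxA
        exact Or.inr (Or.inl ⟨x, hxA, hx, hxy⟩)
      · exact Or.inr (Or.inl ⟨k, hk, hvk, conn_trans hkx hxy⟩)
      · -- `x` reached inside `F₂` from the gate `k'` is a gate; collapse the chain
        have hxK : x ∉ cluster ends (sepConfig ends {a₁, a₃}) o :=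
          not_mem_of_conn_restrictTo_compl (not_mem_cluster_of_mem_pair ho hk') hk'x
        have hxA : x ∈ ({a₁, a₃} : Set V) := by
          rcases (endpoints_mem_of_mem_touches_cluster ho heF hends).1 with hxK' | hxA
          · exact absurd hxK' hxK
          · exact hxA
        by_cases hxk' : x = k'
        · subst hxk'
          exact Or.inr (Or.inl ⟨k, hk, hvk, conn_trans hkk' hxy⟩)
        · rcases eq_or_eq_of_mem_pair hk hk' hxA hxk' with hkx | hkk'
          · subst hkx
            exact Or.inr (Or.inl ⟨k, hk, hvk, hxy⟩)
          · subst hkk'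
            exact Or.inr (Or.inl ⟨x, hxA, conn_trans hvk hk'x, hxy⟩)
    · -- the edge lies in `F₂`
      have heF₂ : e ∈ (touches ends (cluster ends (sepConfig ends {a₁, a₃}) o))ᶜ := heF
      have hxy : Conn ends
          (restrictTo (touches ends (cluster ends (sepConfig ends {a₁, a₃}) o))ᶜ ω) x y :=
        conn_of_openAdj ⟨e, restrictTo_eq_true_of_mem heF₂ he, hends⟩
      rcases hx with hx | ⟨k, hk, hvk, hkx⟩ | ⟨k, hk, k', hk', hvk, hkk', hk'x⟩
      · exact Or.inl (conn_trans hx hxy)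
      · -- `x` reached inside `F₁` from the gate `k` lies in `K ∪ A`, not in `K`: a gate
        have hxA : x ∈ ({a₁, a₃} : Set V) := by
          rcases mem_union_of_conn_restrictTo_touches ho (Or.inr hk) hkx with hxK | hxA
          · exact absurd (mem_touches_of_ends hends (Or.inl hxK)) heF
          · exact hxA
        exact Or.inr (Or.inr ⟨k, hk, x, hxA, hvk, hkx, hxy⟩)
      · exact Or.inr (Or.inr ⟨k, hk, k', hk', hvk, hkk', conn_trans hk'x hxy⟩)
  · rintro (h | ⟨k, _, hvk, hkz⟩ | ⟨k, _, k', _, hvk, hkk', hk'z⟩)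
    · exact conn_of_conn_restrictTo h
    · exact conn_trans (conn_of_conn_restrictTo hvk) (conn_of_conn_restrictTo hkz)
    · exact conn_trans (conn_of_conn_restrictTo hvk)
        (conn_trans (conn_of_conn_restrictTo hkk') (conn_of_conn_restrictTo hk'z))

end Reach

end SepThreeGcZero

end Summit.Ventures.PercRepro2
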